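import Literature.Probability.RandomPlanarGeometry.SelfAvoidingWalk
import Literature.Probability.LatticeModels.TriangularLattice
import Mathlib.Analysis.SpecialFunctions.Sqrt
import HarnessLib
import HarnessLib.Audit

/-!
# The critical self-avoiding walk on the hexagonal lattice (Duminil-Copin–Smirnov)

Topic `Literature/Probability/RandomPlanarGeometry`; definition request `defn-HexSAWLaw` (route
`CriticalPhenomena/SAWHexUniversality`): the objects of Duminil-Copin–Smirnov, *The connective
constant of the honeycomb lattice equals `√(2+√2)`*, Ann. of Math. 175 (2012)
(arXiv:1007.0575), §1 (the connective constant `μ` of `ℍ`), Theorem 1 (`μ = √(2+√2)`), and §4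
before Conjecture 1: "let `Ω ≠ ℂ` be a simply connected domain … with two points `a` and `b` on
the boundary. For `δ > 0`, we consider the discrete approximation given by the largest finite
domain `Ω_δ` of `δℍ` included in `Ω`, and `a_δ` and `b_δ` to be the vertices of `Ω_δ` closest to
`a` and `b` respectively. A probability measure `P_{x,δ}` is defined on the set of self-avoiding
trajectories `γ` between `a_δ` and `b_δ` that remain in `Ω_δ` by assigning to `γ` a weight
proportional to `x^{ℓ(γ)}`", `ℓ(γ)` = "the number of vertices visited by `γ`" (§1), and
Conjecture 1 (the law of `γ_δ` at `x = x_c = 1/√(2+√2)` converges to chordal SLE_{8/3}).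

`SelfAvoidingWalk.lean` (`Literature.SAW.{DomainSAW, weight, law, IsEndpointApprox, SAWScalingLimit}`)
does this for `δℤ²` with the graph `discreteDomainGraph` hard-wired. As the request suggests,
this file first GENERALISES those notions to an arbitrary graph `G` on `V` with a planar embedding
`emb : V → ℂ` (namespace `Literature.SAW`, prefix `emb`), then SPECIALISES to the honeycomb lattice
`hexGraph` of `TriangularLattice.lean` (vertices `HexVertex` = faces of the triangular lattice,
embedded by `hexCenter`, the barycentres of the triangular faces, which form the embedded
honeycomb lattice — the vertices a hexagonal-lattice SAW runs through).

## Contents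

Generic (`G : SimpleGraph V`, `emb : V → ℂ`, domain `Ω : Set ℂ`, mesh `δ : ℝ`):
* `sawCount G v₀ n` — number of `n`-step self-avoiding walks of `G` from `v₀`;
* `embMeshVertices`, `embMeshGraph`, `embMeshVertexGraph`, `embMeshDomain`, `embDomainGraph` —
  the discretisation `Ω_δ` of `Ω` by `δ · emb(G)`: vertices with `δ emb v ∈ Ω`, edges of `G`
  whose rescaled straight segment stays in `Ω̄`, largest connected component (same conventions
  as `DomainDiscretisation.lean` for `δℤ²`);
* `EmbDomainSAW G emb Ω δ a b` — SAWs of `Ω_δ` from `a` to `b`, `length`, `curve` (polyline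
  through `δ emb ωⱼ`, modulo reparametrisation);
* `embWeight … x a b` — the measure `γ ↦ x^{ℓ(γ)}`, `ℓ(γ) = length + 1` vertices;
  `embLaw … x a b` — its normalisation `P_{x,δ}`;
* `IsEmbEndpointApprox G emb D a b` — hypothesis structure for the lattice endpoints.
Hexagonal lattice:
* `hexSawCount n = cₙ(ℍ)`, `hexCriticalFugacity = x_c = 1/√(2+√2)`;
* `HexDomainSAW`, `hexSAWWeight`, **`hexSAWLaw Ω δ a b`** (the requested `HexSAWLaw`: `P_{x_c,δ}`
  on SAWs of `Ω_δ ⊆ δℍ` from `a` to `b`), `HexDomainSAW.curve`;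
* NAMED FACT `DuminilCopinSmirnov2012_thm1` — `cₙ(ℍ)^{1/n} → √(2+√2)` (Theorem 1 with the
  definition `μ := lim cₙ^{1/n}` of §1);
* `HexSAWScalingLimit` — Conjecture 1 as a `def : Prop`: a registered OPEN CONJECTURE
  (`[status: open]`), not a named fact — see "Registry" below.

## Registry: `HexSAWScalingLimit` is an OPEN statement (verdict clean-up 2026-08-15)

Seated as a named fact, `HexSAWScalingLimit` came back from its prove-seat with the verdict *open
problem*. Re-read against the source (arXiv:1007.0575 = Ann. of Math. 175 (2012) 1653–1665): the
paper PROVES only Theorem 1 (vendored as `DuminilCopinSmirnov2012_thm1`) and in §4 "Conjectures"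
(arXiv p. 9) POSES Conjecture 1 after Lawler–Schramm–Werner 2004; still open in 2023–2026 (cites
in the docstring). Hence a *registered open statement* (CONVENTIONS §4: `def … : Prop`, never
asserted; docstring `OPEN CONJECTURE — … [status: open]`): no `HexSAWScalingLimit_holds` is to be
expected, users take `(h : HexSAWScalingLimit)`. Statement byte-for-byte unchanged (faithful; the
`δℤ²` transposition is `SAWScalingLimit`); NAME KEPT (no `…Conjecture` rename) because it is used
by its qualified name in `Summits/CriticalPhenomena/SAWScalingLimit/Theses/SAWHexUniversality.lean`
(`HexConjecture`, item `stmt-CriticalPhenomena-0808`) and in the docstrings of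
`Literature/Barriers/CriticalPhenomena/ParafermionicHalfCauchyRiemann.lean`.

## Design choices

* `sawCount` counts pairs (endpoint, walk) with `IsPath` and `length = n` by `Set.ncard` on the
  Σ-type — no `Fintype`/`LocallyFinite` instance needed at definition time (finite for locally
  finite `G`; `hexGraph` has degree `3`, `card_neighborSet_hexGraph`).
* "Largest finite domain of `δℍ` included in `Ω`": vertices `δ·hexCenter f ∈ Ω`, honeycomb edges
  whose rescaled segment lies in `Ω̄` (relevant for slit domains), largest component(s) by
  `Set.ncard` (union if tied; meaningful for bounded `Ω`, `δ > 0`), exactly as `meshDomain`.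
* Endpoints are quantified through `IsEmbEndpointApprox` (reachable in `Ω_δ` for small `δ`, mesh
  points converge to the marked prime ends), replacing "closest vertices" (tie-breaking, may fall
  outside `Ω_δ`), as in `Literature.Probability.RandomPlanarGeometry.SAW.IsEndpointApprox`.
* Weight `x^{ℓ(γ)}` with `ℓ = length + 1` (DCS count vertices); for fixed endpoints the extra
  factor `x` cancels in `P_{x,δ}`, so `embLaw` agrees with the `x^{#steps}` convention of
  `Literature.Probability.RandomPlanarGeometry.SAW.law`.
* The generic layer is not retro-fitted onto `Literature.Probability.RandomPlanarGeometry.SAW.DomainSAW` (which is imported by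
  `Summits/CriticalPhenomena/Statement.lean`); `embDomainGraph (zdGraph 2) Site.toComplex` is
  the same graph as `discreteDomainGraph` by construction, recorded as `embMeshGraph_zd`.
-/

noncomputable section

open MeasureTheory Filter Topology Literature.Probability.LatticeModels Literature.Probability.Percolation
open scoped NNReal ENNReal

namespace Literature.Probability.RandomPlanarGeometry.SAW

/-! ### Generic layer: SAWs of an embedded graph -/

section Embedded

variable {V : Type*} (G : SimpleGraph V) (emb : V → ℂ)

/-- `cₙ(G, v₀)`: the number of `n`-step self-avoiding walks of `G` started at `v₀` — pairs
(endpoint `v`, walk `v₀ → v` of length `n` visiting no vertex twice), counted by `Set.ncard`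
(finite when `G` is locally finite). DCS §1: "Denote by `cₙ` the number of `n`-step self-avoiding
walks on the hexagonal lattice `ℍ` started from some fixed vertex".
[cite: DuminilCopinSmirnov2012, §1] -/
def sawCount (v₀ : V) (n : ℕ) : ℕ :=
  Set.ncard {p : (v : V) × G.Walk v₀ v | p.2.length = n ∧ p.2.IsPath}

/-- The vertices of `G` whose rescaled embedded point `δ · emb v` lies in `Ω`.
[cite: DuminilCopinSmirnov2012, §4 (before Conjecture 1)] -/
def embMeshVertices (Ω : Set ℂ) (δ : ℝ) : Set V := {v | (δ : ℂ) * emb v ∈ Ω}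

/-- Membership in `embMeshVertices`. [folklore] -/
@[simp] theorem mem_embMeshVertices_iff {Ω : Set ℂ} {δ : ℝ} {v : V} :
    v ∈ embMeshVertices emb Ω δ ↔ (δ : ℂ) * emb v ∈ Ω := Iff.rfl

/-- The mesh graph of `Ω` at scale `δ` for the embedded graph `(G, emb)`: an edge `x ∼ y` of `G`
is kept iff the rescaled straight segment `[δ emb x, δ emb y]` lies in `Ω̄` (as for `δℤ²` in
`meshGraph`). [folklore] -/
def embMeshGraph (Ω : Set ℂ) (δ : ℝ) : SimpleGraph V :=
  SimpleGraph.fromRel fun x y =>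
    G.Adj x y ∧ segment ℝ ((δ : ℂ) * emb x) ((δ : ℂ) * emb y) ⊆ closure Ω

/-- Adjacency in `embMeshGraph`, unfolded. [folklore] -/
theorem embMeshGraph_adj_iff {Ω : Set ℂ} {δ : ℝ} {x y : V} :
    (embMeshGraph G emb Ω δ).Adj x y ↔
      G.Adj x y ∧ segment ℝ ((δ : ℂ) * emb x) ((δ : ℂ) * emb y) ⊆ closure Ω := by
  simp only [embMeshGraph, SimpleGraph.fromRel_adj, ne_eq]
  constructor
  · rintro ⟨-, h | h⟩
    · exact h
    · exact ⟨h.1.symm, segment_symm ℝ ((δ : ℂ) * emb y) ((δ : ℂ) * emb x) ▸ h.2⟩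
  · intro h
    exact ⟨h.1.ne, Or.inl h⟩

/-- The mesh graph is a subgraph of `G`. [folklore] -/
theorem embMeshGraph_le (Ω : Set ℂ) (δ : ℝ) : embMeshGraph G emb Ω δ ≤ G :=
  fun _ _ h => ((embMeshGraph_adj_iff G emb).1 h).1

/-- The `δℤ²` mesh graph of `DomainDiscretisation.lean` is the instance `G = zdGraph 2`,
`emb = Site.toComplex`. [folklore] -/
theorem embMeshGraph_zd (Ω : Set ℂ) (δ : ℝ) :
    embMeshGraph (zdGraph 2) Site.toComplex Ω δ = meshGraph Ω δ := by
  ext x y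
  rw [embMeshGraph_adj_iff, meshGraph_adj_iff]
  rfl

/-- The mesh graph induced on the mesh vertices; its connected components are the candidate
discrete domains. [folklore] -/
abbrev embMeshVertexGraph (Ω : Set ℂ) (δ : ℝ) : SimpleGraph (embMeshVertices emb Ω δ) :=
  (embMeshGraph G emb Ω δ).induce (embMeshVertices emb Ω δ)

/-- The vertex set of the discrete domain `Ω_δ`: the union of the supports of the connected
components of `embMeshVertexGraph` of maximal `Set.ncard` — DCS's "largest finite domain `Ω_δ` of
`δℍ` included in `Ω`" (union if several are largest; meaningful when the mesh vertices are
finite, i.e. `Ω` bounded, `δ > 0`, `emb(G)` locally finite in `ℂ`).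
[cite: DuminilCopinSmirnov2012, §4 (before Conjecture 1)] -/
def embMeshDomain (Ω : Set ℂ) (δ : ℝ) : Set V :=
  ⋃ (C : (embMeshVertexGraph G emb Ω δ).ConnectedComponent)
    (_ : ∀ C' : (embMeshVertexGraph G emb Ω δ).ConnectedComponent,
      C'.supp.ncard ≤ C.supp.ncard),
    Subtype.val '' C.supp

/-- The discrete domain consists of mesh vertices. [folklore] -/
theorem embMeshDomain_subset (Ω : Set ℂ) (δ : ℝ) :
    embMeshDomain G emb Ω δ ⊆ embMeshVertices emb Ω δ := by
  intro x hx
  simp only [embMeshDomain, Set.mem_iUnion, Set.mem_image] at hx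
  obtain ⟨_, _, y, _, rfl⟩ := hx
  exact y.2

/-- The graph `Ω_δ`: the mesh graph restricted to the discrete domain (as a graph on all of `V`,
vertices outside `Ω_δ` isolated). [cite: DuminilCopinSmirnov2012, §4 (before Conjecture 1)] -/
def embDomainGraph (Ω : Set ℂ) (δ : ℝ) : SimpleGraph V :=
  SimpleGraph.fromRel fun x y =>
    (embMeshGraph G emb Ω δ).Adj x y ∧ x ∈ embMeshDomain G emb Ω δ ∧ y ∈ embMeshDomain G emb Ω δ

/-- Adjacency in `Ω_δ`, unfolded. [folklore] -/
theorem embDomainGraph_adj_iff {Ω : Set ℂ} {δ : ℝ} {x y : V} :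
    (embDomainGraph G emb Ω δ).Adj x y ↔
      (embMeshGraph G emb Ω δ).Adj x y ∧
        x ∈ embMeshDomain G emb Ω δ ∧ y ∈ embMeshDomain G emb Ω δ := by
  simp only [embDomainGraph, SimpleGraph.fromRel_adj, ne_eq]
  constructor
  · rintro ⟨-, h | h⟩
    · exact h
    · exact ⟨h.1.symm, h.2.2, h.2.1⟩
  · intro h
    exact ⟨h.1.ne, Or.inl h⟩

/-- `Ω_δ` is a subgraph of `G`. [folklore] -/
theorem embDomainGraph_le (Ω : Set ℂ) (δ : ℝ) : embDomainGraph G emb Ω δ ≤ G :=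
  fun _ _ h => embMeshGraph_le G emb Ω δ ((embDomainGraph_adj_iff G emb).1 h).1

/-- A **self-avoiding walk of the discrete domain `Ω_δ ⊆ δ·emb(G)` from `a` to `b`**: a walk of
`embDomainGraph G emb Ω δ` visiting no vertex twice ("self-avoiding trajectories `γ` between `a_δ`
and `b_δ` that remain in `Ω_δ`"). [cite: DuminilCopinSmirnov2012, §4 (before Conjecture 1)] -/
structure EmbDomainSAW (Ω : Set ℂ) (δ : ℝ) (a b : V) where
  /-- the underlying walk in `Ω_δ` -/
  walk : (embDomainGraph G emb Ω δ).Walk a b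
  /-- the walk is self-avoiding -/
  isPath : walk.IsPath

namespace EmbDomainSAW

variable {G emb} {Ω : Set ℂ} {δ : ℝ} {a b : V}

/-- Discrete σ-algebra on the set of SAWs. [folklore] -/
instance : MeasurableSpace (EmbDomainSAW G emb Ω δ a b) := ⊤

/-- Every map out of the space of SAWs is measurable (discrete σ-algebra). [folklore] -/
theorem measurable_of_top {β : Type*} [MeasurableSpace β] (f : EmbDomainSAW G emb Ω δ a b → β) :
    Measurable f :=
  fun _ _ => MeasurableSpace.measurableSet_top

/-- The number of steps of a SAW. [cite: DuminilCopinSmirnov2012, §1] -/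
def length (γ : EmbDomainSAW G emb Ω δ a b) : ℕ :=
  γ.walk.length

/-- `ℓ(γ)`, "the number of vertices visited by `γ`" (`= length + 1`).
[cite: DuminilCopinSmirnov2012, §1] -/
def vertexCount (γ : EmbDomainSAW G emb Ω δ a b) : ℕ :=
  γ.length + 1

/-- The trivial SAW at a vertex. [folklore] -/
def nil (a : V) : EmbDomainSAW G emb Ω δ a a :=
  ⟨SimpleGraph.Walk.nil, SimpleGraph.Walk.IsPath.nil⟩

/-- The trivial SAW has length `0`. [folklore] -/
@[simp] theorem length_nil (a : V) : (nil a : EmbDomainSAW G emb Ω δ a a).length = 0 := rfl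

/-- The trivial SAW visits one vertex. [folklore] -/
@[simp] theorem vertexCount_nil (a : V) : (nil a : EmbDomainSAW G emb Ω δ a a).vertexCount = 1 :=
  rfl

/-- A SAW as a point of the curve space: the polyline through the rescaled embedded vertices
`δ emb ω₀, …, δ emb ωₙ`, modulo reparametrisation ("We obtain a random curve denoted `γ_δ`").
[cite: DuminilCopinSmirnov2012, §4 (before Conjecture 1)] -/
def curve (γ : EmbDomainSAW G emb Ω δ a b) : CurveClass ℂ :=
  CurveClass.mk ⟨γ.walk.toCurve fun v => (δ : ℂ) * emb v⟩

end EmbDomainSAW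

/-- The **SAW measure at fugacity `x`** on SAWs of `Ω_δ` from `a` to `b`: `γ` gets mass
`x^{ℓ(γ)}`, `ℓ(γ)` the number of vertices (a sum of weighted Dirac masses; `x < 0` gives the junk
truncation `ENNReal.ofReal`). [cite: DuminilCopinSmirnov2012, §4 (before Conjecture 1)] -/
def embWeight (Ω : Set ℂ) (δ : ℝ) (x : ℝ) (a b : V) : Measure (EmbDomainSAW G emb Ω δ a b) :=
  Measure.sum fun γ => ENNReal.ofReal (x ^ γ.vertexCount) • Measure.dirac γ

/-- The **law `P_{x,δ}`** on SAWs of `Ω_δ` from `a` to `b`: "assigning to `γ` a weight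
proportional to `x^{ℓ(γ)}`", normalised; junk `0` when there is no such SAW or the total weight
is infinite. [cite: DuminilCopinSmirnov2012, §4 (before Conjecture 1)] -/
def embLaw (Ω : Set ℂ) (δ : ℝ) (x : ℝ) (a b : V) : Measure (EmbDomainSAW G emb Ω δ a b) :=
  (embWeight G emb Ω δ x a b Set.univ)⁻¹ • embWeight G emb Ω δ x a b

/-- The weight of a single SAW is `x^{ℓ(γ)}`. [cite: DuminilCopinSmirnov2012, §4] -/
theorem embWeight_singleton {Ω : Set ℂ} {δ : ℝ} (x : ℝ) {a b : V}
    (γ : EmbDomainSAW G emb Ω δ a b) :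
    embWeight G emb Ω δ x a b {γ} = ENNReal.ofReal (x ^ γ.vertexCount) := by
  rw [embWeight, Measure.sum_apply _ MeasurableSpace.measurableSet_top, tsum_eq_single γ]
  · simp
  · intro γ' hγ'
    simp [hγ']

/-- The observable `γ ↦ γ.curve` is measurable (discrete σ-algebra). [folklore] -/
theorem aemeasurable_embCurve (Ω : Set ℂ) (δ x : ℝ) (a b : V) :
    AEMeasurable (fun γ : EmbDomainSAW G emb Ω δ a b => γ.curve) (embLaw G emb Ω δ x a b) :=
  (EmbDomainSAW.measurable_of_top _).aemeasurable

/-- Hypothesis structure: **the lattice endpoints `a δ, b δ : V` approximate the marked boundary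
points of the Dobrushin domain `D = (Ω; a, b)`** as `δ → 0⁺`: for small `δ > 0` they are joined
in `Ω_δ`, and `δ emb (a δ) → D.pt 0`, `δ emb (b δ) → D.pt 1` (replacing "`a_δ` and `b_δ` … the
vertices of `Ω_δ` closest to `a` and `b`"). [cite: DuminilCopinSmirnov2012, §4 (before Conjecture 1)] -/
structure IsEmbEndpointApprox (D : DobrushinDomain) (a b : ℝ → V) : Prop where
  /-- for small `δ > 0`, `a δ` and `b δ` are joined in `Ω_δ` -/
  reachable : ∀ᶠ δ in 𝓝[>] (0 : ℝ), (embDomainGraph G emb D.carrier δ).Reachable (a δ) (b δ)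
  /-- `δ emb (a δ) → a` -/
  tendsto_fst : Tendsto (fun δ : ℝ => (δ : ℂ) * emb (a δ)) (𝓝[>] (0 : ℝ)) (𝓝 (D.pt 0))
  /-- `δ emb (b δ) → b` -/
  tendsto_snd : Tendsto (fun δ : ℝ => (δ : ℂ) * emb (b δ)) (𝓝[>] (0 : ℝ)) (𝓝 (D.pt 1))

end Embedded

/-! ### The hexagonal (honeycomb) lattice -/

/-- `cₙ = cₙ(ℍ)`, the number of `n`-step self-avoiding walks on the hexagonal lattice from a fixed
vertex (the up-face of the cell `0`; independent of the choice by transitivity).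
[cite: DuminilCopinSmirnov2012, §1] -/
def hexSawCount (n : ℕ) : ℕ :=
  sawCount hexGraph ((0 : Site 2), (0 : Fin 2)) n

/-- The **critical fugacity of the honeycomb lattice**, `x_c := 1/√(2+√2)` (DCS §1: "below we set
`x_c := 1/√(2+√2)`"). [cite: DuminilCopinSmirnov2012, §1] -/
def hexCriticalFugacity : ℝ :=
  (Real.sqrt (2 + Real.sqrt 2))⁻¹

/-- The discrete domain graph `Ω_δ ⊆ δℍ`: `embDomainGraph` for the honeycomb lattice `hexGraph`
embedded by `hexCenter`. [cite: DuminilCopinSmirnov2012, §4 (before Conjecture 1)] -/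
abbrev hexDomainGraph (Ω : Set ℂ) (δ : ℝ) : SimpleGraph HexVertex :=
  embDomainGraph hexGraph hexCenter Ω δ

/-- Self-avoiding walks of `Ω_δ ⊆ δℍ` from `a` to `b`. [cite: DuminilCopinSmirnov2012, §4 (before Conjecture 1)] -/
abbrev HexDomainSAW (Ω : Set ℂ) (δ : ℝ) (a b : HexVertex) : Type :=
  EmbDomainSAW hexGraph hexCenter Ω δ a b

/-- The critical SAW measure `γ ↦ x_c^{ℓ(γ)}` on SAWs of `Ω_δ ⊆ δℍ` from `a` to `b`.
[cite: DuminilCopinSmirnov2012, §4 (before Conjecture 1)] -/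
abbrev hexSAWWeight (Ω : Set ℂ) (δ : ℝ) (a b : HexVertex) : Measure (HexDomainSAW Ω δ a b) :=
  embWeight hexGraph hexCenter Ω δ hexCriticalFugacity a b

/-- **`HexSAWLaw`** — the law `P_{x_c,δ}` of the critical self-avoiding walk of the hexagonal
lattice in `(Ω_δ, a, b)`: the probability measure on SAWs of `Ω_δ ⊆ δℍ` from `a` to `b` with
`P(γ) ∝ x_c^{ℓ(γ)}`, `x_c = 1/√(2+√2)` (DCS §4 before Conjecture 1, at `x = x_c`). Junk `0` if
`a`, `b` are not joined in `Ω_δ`. [cite: DuminilCopinSmirnov2012, §4 (before Conjecture 1)] -/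
abbrev hexSAWLaw (Ω : Set ℂ) (δ : ℝ) (a b : HexVertex) : Measure (HexDomainSAW Ω δ a b) :=
  embLaw hexGraph hexCenter Ω δ hexCriticalFugacity a b

/-- NAMED FACT — **Duminil-Copin–Smirnov 2012, Theorem 1**: "For the hexagonal lattice,
`μ = √(2+√2)`", where (§1) "`c_{n+m} ≤ cₙ c_m`, from which it follows that there exists
`μ ∈ (0, +∞)` such that `μ := lim_{n→∞} cₙ^{1/n}`. The positive real number `μ` is called the
connective constant of the hexagonal lattice." Vendored as the conjunction of both printed
statements: `cₙ(ℍ)^{1/n} → √(2+√2)`. Users take `(h : DuminilCopinSmirnov2012_thm1)`.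
[cite: DuminilCopinSmirnov2012, Thm 1] -/
def DuminilCopinSmirnov2012_thm1 : Prop :=
  Tendsto (fun n : ℕ => (hexSawCount n : ℝ) ^ (1 / (n : ℝ))) atTop
    (𝓝 (Real.sqrt (2 + Real.sqrt 2)))

/-- OPEN CONJECTURE — **Duminil-Copin–Smirnov 2012, Conjecture 1: the critical self-avoiding walk
on the hexagonal lattice converges to chordal SLE_{8/3}**, posed in H. Duminil-Copin, S. Smirnov,
*The connective constant of the honeycomb lattice equals `√(2+√2)`*, Ann. of Math. 175 (2012)
1653–1665, §4 "Conjectures", Conjecture 1 (= arXiv:1007.0575, p. 9), after Lawler–Schramm–Werner,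
*On the scaling limit of planar self-avoiding walk*, Proc. Sympos. Pure Math. 72 (2004), §1 and
§3.4 (existence + conformal covariance of the scaling limit ⇒ SLE_{8/3}) [status: open]:
"Let `Ω` be a simply connected domain (not equal to `ℂ`) with two distinct points `a, b` on its
boundary. For `x = x_c`, the law of `γ_δ` in `(Ω_δ, a_δ, b_δ)` converges when `δ → 0` to the
(chordal) Schramm–Loewner Evolution with parameter `κ = 8/3` in `Ω` from `a` to `b`." Stated for
bounded Jordan domains with two marked prime ends (`DobrushinDomain`), every endpoint
approximation (`IsEmbEndpointApprox`), the law `hexSAWLaw` pushed to curves modulo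
reparametrisation, and the library's convergence in law to chordal SLE (`ConvergesInLawToSLE`);
the `δℤ²` analogue is `SAWScalingLimit`.
Status (re-verified 2026-08-15): open. The source proves only Theorem 1 (`μ = √(2+√2)`,
`DuminilCopinSmirnov2012_thm1`) and writes (p. 10) that proving its Conjecture 2 (conformal
covariance of the parafermionic observable) "would be a major step toward Conjecture 1"; the
obstruction — the observable satisfies only half of the discrete Cauchy–Riemann relations — is the
tree's barrier `Literature.Barriers.CriticalPhenomena.ParafermionicHalfCauchyRiemann`; the 2023
literature still calls the planar SAW scaling limit "conjectural" (Krachun–Panagiotis,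
arXiv:2310.17299, p. 3). A registered open statement (CONVENTIONS §4), not a named fact: no
`HexSAWScalingLimit_holds` is to be expected; users take `(h : HexSAWScalingLimit)` (route
`SAWHexUniversality`, `HexConjecture`). Name kept (it has users, see the module docstring
"Registry"). [cite: DuminilCopinSmirnov2012, §4 Conjecture 1] -/
@[conjecture] def HexSAWScalingLimit : Prop :=
  ∀ (D : DobrushinDomain) (a b : ℝ → HexVertex), IsEmbEndpointApprox hexGraph hexCenter D a b →
    ConvergesInLawToSLE ((8 : ℝ≥0) / 3) D
      (fun δ (γ : HexDomainSAW D.carrier δ (a δ) (b δ)) => γ.curve)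
      (fun δ => hexSAWLaw D.carrier δ (a δ) (b δ))

/-! ### API -/

/-- `x_c = 1/√(2+√2)` is a genuine number in `(0, 1)`. [folklore] -/
theorem hexCriticalFugacity_pos_lt_one : 0 < hexCriticalFugacity ∧ hexCriticalFugacity < 1 := by
  have h2 : (1 : ℝ) < Real.sqrt (2 + Real.sqrt 2) := by
    rw [show (1 : ℝ) = Real.sqrt 1 by simp]
    exact Real.sqrt_lt_sqrt zero_le_one (by linarith [Real.sqrt_nonneg 2])
  refine ⟨inv_pos.mpr (by linarith), ?_⟩
  rw [hexCriticalFugacity, inv_lt_one_iff₀]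
  exact Or.inr h2

/-- `x_c² · (2 + √2) = 1`, i.e. `x_c = 1/√(2+√2)` squared. [cite: DuminilCopinSmirnov2012, §1] -/
theorem hexCriticalFugacity_sq : hexCriticalFugacity ^ 2 * (2 + Real.sqrt 2) = 1 := by
  have h : (0 : ℝ) ≤ 2 + Real.sqrt 2 := by positivity
  rw [hexCriticalFugacity, inv_pow, Real.sq_sqrt h, inv_mul_cancel₀ (by positivity)]

/-- Under Theorem 1, the connective constant of `ℍ` is `μ = 1/x_c`. [cite: DuminilCopinSmirnov2012, Thm 1] -/
theorem DuminilCopinSmirnov2012_thm1.tendsto_inv (h : DuminilCopinSmirnov2012_thm1) :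
    Tendsto (fun n : ℕ => (hexSawCount n : ℝ) ^ (1 / (n : ℝ))) atTop
      (𝓝 hexCriticalFugacity⁻¹) := by
  rwa [hexCriticalFugacity, inv_inv]

/-- `c₀(ℍ) = 1`: the only `0`-step walk is the trivial one. [folklore] -/
theorem hexSawCount_zero : hexSawCount 0 = 1 := by
  rw [hexSawCount, sawCount, Set.ncard_eq_one]
  refine ⟨⟨_, SimpleGraph.Walk.nil⟩, ?_⟩
  ext ⟨v, w⟩
  simp only [Set.mem_setOf_eq, Set.mem_singleton_iff]
  constructor
  · rintro ⟨hl, -⟩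
    obtain rfl := SimpleGraph.Walk.eq_of_length_eq_zero hl
    obtain rfl := SimpleGraph.Walk.eq_nil_iff_nil.mpr (SimpleGraph.Walk.length_eq_zero_iff.mp hl)
    rfl
  · rintro h
    cases h
    exact ⟨rfl, SimpleGraph.Walk.IsPath.nil⟩

/-- The weight of a single hexagonal SAW is `x_c^{ℓ(γ)}`. [cite: DuminilCopinSmirnov2012, §4] -/
theorem hexSAWWeight_singleton {Ω : Set ℂ} {δ : ℝ} {a b : HexVertex} (γ : HexDomainSAW Ω δ a b) :
    hexSAWWeight Ω δ a b {γ} = ENNReal.ofReal (hexCriticalFugacity ^ γ.vertexCount) :=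
  embWeight_singleton _ _ _ γ

/-- `P_{x,δ}` is a probability measure as soon as the total weight is neither `0` (some SAW from
`a` to `b` exists and `x > 0`) nor `∞` (finitely many SAWs). [folklore] -/
theorem isProbabilityMeasure_embLaw {V : Type*} {G : SimpleGraph V} {emb : V → ℂ}
    {Ω : Set ℂ} {δ x : ℝ} {a b : V} (h0 : embWeight G emb Ω δ x a b Set.univ ≠ 0)
    (hfin : embWeight G emb Ω δ x a b Set.univ ≠ ∞) :
    IsProbabilityMeasure (embLaw G emb Ω δ x a b) :=
  ⟨by rw [embLaw, Measure.smul_apply, smul_eq_mul, ENNReal.inv_mul_cancel h0 hfin]⟩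

/-- In particular for the hexagonal law `hexSAWLaw`. [folklore] -/
theorem isProbabilityMeasure_hexSAWLaw {Ω : Set ℂ} {δ : ℝ} {a b : HexVertex}
    (h0 : hexSAWWeight Ω δ a b Set.univ ≠ 0) (hfin : hexSAWWeight Ω δ a b Set.univ ≠ ∞) :
    IsProbabilityMeasure (hexSAWLaw Ω δ a b) :=
  isProbabilityMeasure_embLaw h0 hfin

end Literature.Probability.RandomPlanarGeometry.SAW
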